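import Literature.NumberTheory.NumberFields.SqrtTwoTowerOrderFourClassCertificate
import Literature.NumberTheory.IwasawaTheory.ClassNumberPExpLayerOneGeTwoOfOrderFourCertificate
import Literature.NumberTheory.IwasawaTheory.ClassicalMuVanishesLayerOneUnitCertificateTwo
import Literature.NumberTheory.IwasawaTheory.ClassGroupPRankLeOfNotElementaryLayer
import HarnessLib

/-!
# A CLASS OF ORDER `4` IN `Cl(K_2)` FROM THE BASE FIELD: the second layer `K_2 = K(√2, √(2+√2))` of the cyclotomic `ℤ₂`-extension of an
# odd-degree field `K` (`2 ∤ d_K`) has an ideal class of order `4` as soon as an ORDER-FOUR CERTIFICATE written in `𝓞_K` is supplied;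
# hence (att-p3 g47's elementary-layer door) `μ₂ = 0`, `λ₂ ≤ 2` when moreover `2 ∤ h_K` and `e₁ ≤ 1`

`Proofs`-style file (theorems only: no definition, no named fact, no instance, no `sorry`) in topic `NumberTheory/IwasawaTheory` (namespace = path),
written by the prover seat `bsd-line-att-p4` g41 (cell `bsd-f1-sign2`, route `AlignedTransportAtTwo`; `--supports` stmt-BirchSwinnertonDyer-22298, closes
nothing).  It is the `ℤ₂`-tower packaging of this seat's `NumberFields/SqrtTwoTowerOrderFourClassCertificate` (a class of order `4` in `Cl(L)`,
`L = K(s₁, s₂)`, `s₁² = 2`, `s₂² = 2 + s₁`, from `n ≥ rank E_L` units modulo `±` squares and an explicit ideal `(b, v)` with `(b,v)² = (w,b²)` non-principal,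
`(w,b²)² = (w)`), the layer-two analogue of g40's `ClassNumberPExpLayerOneGeTwoOfOrderFourCertificate` (`e₁ ≥ 2`): every datum about the abstract
layer `K_2` is replaced by IDENTITIES IN `𝓞_K` between coordinates on the basis `1, s₁, s₂, s₁s₂` — so that a Summits row can decide them in `ℤ[θ]` by
`linear_combination` and the residue characters by `decide`.

* ★★ `exists_orderOf_eq_four_layer_two_of_towerCert` — `K` with `2 ∤ [K:ℚ]`, `2 ∤ d_K`, `4·#Pl_∞(K) ≤ n + 1`, `κ` cyclotomic; coordinates of `n` units of
  `K_2` with inverses, of `w`, `w*` with `q₀⁴ = w·w*`, Bézout `μw + νw* = 1`, `q₀ ≠ 0`, `v` and witnesses for `(q₀, v)² = (w, q₀²)`, and the residue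
  certificates (existential form; supplied in practice by `NumberFields.towerCert_of_charMatrix`) ⟹ **`∃ c ∈ Cl(K_2)`, `orderOf c = 4`**.
* ★★★ `classicalMuVanishes_two_of_layer_two_towerCert` — if moreover `2 ∤ h_K` and `e₁ ≤ 1`: **`rank₂ Cl(K_m) ≤ 2 ∀ m`, `μ₂ = 0`, `λ₂ ≤ 2`**
  (att-p3 g47's `classicalMuVanishes_two_of_orderOf_eq_four_of_not_dvd_discr` at `k = 2`).

CELL READING (crux C2, u7 sub-cell, HARD CORE `t = 3 ∧ e₁ = 1`, seeds `N = 3027, 9139`): the census says `Cl(K_2)[2^∞] ≅ (ℤ/4)²`; ONE class of order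
`4`, certified here from `ℤ[θ]`-data, is the displayed input of the elementary-layer door and settles `μ₂ = 0` for the seed's cyclotomic tower.
Nothing about any seed is asserted here; BSD is not advanced by this file.

References: [NeukirchANT1999] Ch. I §2, §3, §7 Thm. (7.4), §8; [Cohen1993] §6.5; [Washington1997] §13.1 (`K_1 = K(√2)`, `K_2 = K·ℚ(ζ₁₆)⁺`), §13.3;
[Serre1973CourseArithmetic] Ch. I §3; [Marcus2018] Ch. 3 Thm. 27.
-/

set_option autoImplicit false

noncomputable section

open scoped NumberField nonZeroDivisors
open NumberField IsDedekindDomain Module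

namespace Literature.NumberTheory.IwasawaTheory

open Literature.NumberTheory.EllipticCurves Literature.NumberTheory.NumberFields

variable {K : Type} [Field K] [NumberField K]

/-- ★★ **A class of order `4` in `Cl(K_2)` from a tower order-four certificate in `𝓞_K`.**  `K` a number field with `2 ∤ [K:ℚ]`, `2 ∤ d_K`,
`4·#Pl_∞(K) ≤ n + 1` (so `rank E_{K_2} ≤ n`); `κ` a cyclotomic `ℤ₂`-extension (`K_1 ∋ s₁`, `s₁² = 2`; `K_2 ∋ s₂`, `s₂² = 2 + s₁`).  DATA in `𝓞_K`
(coordinates `(x₀, x₁, x₂, x₃) ↔ x₀ + x₁s₁ + (x₂ + x₃s₁)s₂`, products by the rule `s₁² = 2`, `s₂² = 2 + s₁`): `n` units `a_i` with inverses `c_i`;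
`w = A`, `w* = W` with `q₀⁴ = w·w*`; `μ w + ν w* = 1`; `q₀ ≠ 0`; `v` with `q₀ v = α w + β q₀²`, `v² = γ w + δ q₀²`, `w = m q₀² + n'(q₀ v) + l v²`; and for
every `(e, e', ±) ≠ (0, 0, +)` a residue certificate `ψ : 𝓞_K → ℤ/q`, `2t = 1`, `r₁² = 2`, `r₂² = 2 + r₁` at which `±∏ sym(a_i)^{e_i} sym(A)^{e'}` is not a
square.  THEN `Cl(K_2)` has a class of order `4` (the class of `(q₀, v)`: `NumberFields.exists_orderOf_eq_four_of_towerOrderFourCert`).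
[cite: NeukirchANT1999, Ch. I §7 Thm. (7.4), Ch. I §3, Ch. I §8] [cite: Washington1997, §13.1 (`K_2 = K·ℚ(ζ₁₆)⁺`)]
[cite: Cohen1993, §6.5 (verification of class group and unit computations)] -/
theorem exists_orderOf_eq_four_layer_two_of_towerCert (hK : ¬ 2 ∣ Module.finrank ℚ K) (hd : ¬ (2 : ℤ) ∣ NumberField.discr K)
    {n : ℕ} (hPl : 4 * Fintype.card (NumberField.InfinitePlace K) ≤ n + 1)
    (κ : ZpExtension K 2) (hκ : κ.IsCyclotomic)
    (a₀ a₁ a₂ a₃ c₀ c₁ c₂ c₃ : Fin n → 𝓞 K)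
    {A₀ A₁ A₂ A₃ W₀ W₁ W₂ W₃ μ₀ μ₁ μ₂ μ₃ ν₀ ν₁ ν₂ ν₃ q₀ v₀ v₁ v₂ v₃ α₀ α₁ α₂ α₃ β₀ β₁ β₂ β₃
      γ₀ γ₁ γ₂ γ₃ δ₀ δ₁ δ₂ δ₃ m₀ m₁ m₂ m₃ n₀ n₁ n₂ n₃ l₀ l₁ l₂ l₃ V₀ V₁ V₂ V₃ : 𝓞 K}
    (hu : ∀ i, a₀ i * c₀ i + 2 * a₁ i * c₁ i + 2 * (a₂ i * c₂ i + 2 * a₃ i * c₃ i) + 2 * (a₂ i * c₃ i + a₃ i * c₂ i) = 1 ∧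
      a₀ i * c₁ i + a₁ i * c₀ i + (a₂ i * c₂ i + 2 * a₃ i * c₃ i) + 2 * (a₂ i * c₃ i + a₃ i * c₂ i) = 0 ∧
      a₀ i * c₂ i + 2 * a₁ i * c₃ i + a₂ i * c₀ i + 2 * a₃ i * c₁ i = 0 ∧
      a₀ i * c₃ i + a₁ i * c₂ i + a₂ i * c₁ i + a₃ i * c₀ i = 0)
    (hws : q₀ ^ 4 = A₀ * W₀ + 2 * A₁ * W₁ + 2 * (A₂ * W₂ + 2 * A₃ * W₃) + 2 * (A₂ * W₃ + A₃ * W₂) ∧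
      (0 : 𝓞 K) = A₀ * W₁ + A₁ * W₀ + (A₂ * W₂ + 2 * A₃ * W₃) + 2 * (A₂ * W₃ + A₃ * W₂) ∧
      (0 : 𝓞 K) = A₀ * W₂ + 2 * A₁ * W₃ + A₂ * W₀ + 2 * A₃ * W₁ ∧
      (0 : 𝓞 K) = A₀ * W₃ + A₁ * W₂ + A₂ * W₁ + A₃ * W₀)
    (hbez : (μ₀ * A₀ + 2 * μ₁ * A₁ + 2 * (μ₂ * A₂ + 2 * μ₃ * A₃) + 2 * (μ₂ * A₃ + μ₃ * A₂)) +
        (ν₀ * W₀ + 2 * ν₁ * W₁ + 2 * (ν₂ * W₂ + 2 * ν₃ * W₃) + 2 * (ν₂ * W₃ + ν₃ * W₂)) = 1 ∧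
      (μ₀ * A₁ + μ₁ * A₀ + (μ₂ * A₂ + 2 * μ₃ * A₃) + 2 * (μ₂ * A₃ + μ₃ * A₂)) +
        (ν₀ * W₁ + ν₁ * W₀ + (ν₂ * W₂ + 2 * ν₃ * W₃) + 2 * (ν₂ * W₃ + ν₃ * W₂)) = 0 ∧
      (μ₀ * A₂ + 2 * μ₁ * A₃ + μ₂ * A₀ + 2 * μ₃ * A₁) + (ν₀ * W₂ + 2 * ν₁ * W₃ + ν₂ * W₀ + 2 * ν₃ * W₁) = 0 ∧
      (μ₀ * A₃ + μ₁ * A₂ + μ₂ * A₁ + μ₃ * A₀) + (ν₀ * W₃ + ν₁ * W₂ + ν₂ * W₁ + ν₃ * W₀) = 0)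
    (hq₀ : q₀ ≠ 0)
    (hM2 : q₀ * v₀ = (α₀ * A₀ + 2 * α₁ * A₁ + 2 * (α₂ * A₂ + 2 * α₃ * A₃) + 2 * (α₂ * A₃ + α₃ * A₂)) + β₀ * q₀ ^ 2 ∧
      q₀ * v₁ = (α₀ * A₁ + α₁ * A₀ + (α₂ * A₂ + 2 * α₃ * A₃) + 2 * (α₂ * A₃ + α₃ * A₂)) + β₁ * q₀ ^ 2 ∧
      q₀ * v₂ = (α₀ * A₂ + 2 * α₁ * A₃ + α₂ * A₀ + 2 * α₃ * A₁) + β₂ * q₀ ^ 2 ∧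
      q₀ * v₃ = (α₀ * A₃ + α₁ * A₂ + α₂ * A₁ + α₃ * A₀) + β₃ * q₀ ^ 2)
    (hV : v₀ * v₀ + 2 * v₁ * v₁ + 2 * (v₂ * v₂ + 2 * v₃ * v₃) + 2 * (v₂ * v₃ + v₃ * v₂) = V₀ ∧
      v₀ * v₁ + v₁ * v₀ + (v₂ * v₂ + 2 * v₃ * v₃) + 2 * (v₂ * v₃ + v₃ * v₂) = V₁ ∧
      v₀ * v₂ + 2 * v₁ * v₃ + v₂ * v₀ + 2 * v₃ * v₁ = V₂ ∧
      v₀ * v₃ + v₁ * v₂ + v₂ * v₁ + v₃ * v₀ = V₃)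
    (hM3 : V₀ = (γ₀ * A₀ + 2 * γ₁ * A₁ + 2 * (γ₂ * A₂ + 2 * γ₃ * A₃) + 2 * (γ₂ * A₃ + γ₃ * A₂)) + δ₀ * q₀ ^ 2 ∧
      V₁ = (γ₀ * A₁ + γ₁ * A₀ + (γ₂ * A₂ + 2 * γ₃ * A₃) + 2 * (γ₂ * A₃ + γ₃ * A₂)) + δ₁ * q₀ ^ 2 ∧
      V₂ = (γ₀ * A₂ + 2 * γ₁ * A₃ + γ₂ * A₀ + 2 * γ₃ * A₁) + δ₂ * q₀ ^ 2 ∧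
      V₃ = (γ₀ * A₃ + γ₁ * A₂ + γ₂ * A₁ + γ₃ * A₀) + δ₃ * q₀ ^ 2)
    (hM4 : A₀ = m₀ * q₀ ^ 2 + (n₀ * (q₀ * v₀) + 2 * n₁ * (q₀ * v₁) + 2 * (n₂ * (q₀ * v₂) + 2 * n₃ * (q₀ * v₃)) +
        2 * (n₂ * (q₀ * v₃) + n₃ * (q₀ * v₂))) + (l₀ * V₀ + 2 * l₁ * V₁ + 2 * (l₂ * V₂ + 2 * l₃ * V₃) + 2 * (l₂ * V₃ + l₃ * V₂)) ∧
      A₁ = m₁ * q₀ ^ 2 + (n₀ * (q₀ * v₁) + n₁ * (q₀ * v₀) + (n₂ * (q₀ * v₂) + 2 * n₃ * (q₀ * v₃)) +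
        2 * (n₂ * (q₀ * v₃) + n₃ * (q₀ * v₂))) + (l₀ * V₁ + l₁ * V₀ + (l₂ * V₂ + 2 * l₃ * V₃) + 2 * (l₂ * V₃ + l₃ * V₂)) ∧
      A₂ = m₂ * q₀ ^ 2 + (n₀ * (q₀ * v₂) + 2 * n₁ * (q₀ * v₃) + n₂ * (q₀ * v₀) + 2 * n₃ * (q₀ * v₁)) +
        (l₀ * V₂ + 2 * l₁ * V₃ + l₂ * V₀ + 2 * l₃ * V₁) ∧
      A₃ = m₃ * q₀ ^ 2 + (n₀ * (q₀ * v₃) + n₁ * (q₀ * v₂) + n₂ * (q₀ * v₁) + n₃ * (q₀ * v₀)) +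
        (l₀ * V₃ + l₁ * V₂ + l₂ * V₁ + l₃ * V₀))
    (hcert : ∀ (e : Fin n → ℕ) (e' : ℕ) (σ : ℤˣ), (∀ i, e i ≤ 1) → e' ≤ 1 → ¬ (e = 0 ∧ e' = 0 ∧ σ = 1) →
      ∃ (q : ℕ) (ψ : 𝓞 K →+* ZMod q) (t r₁ r₂ : ZMod q), 2 * t = 1 ∧ r₁ ^ 2 = 2 ∧ r₂ ^ 2 = 2 + r₁ ∧
        ¬ IsSquare (((σ : ℤ) : ZMod q) *
          (∏ i, (ψ (a₀ i) + ψ (a₁ i) * r₁ + (ψ (a₂ i) + ψ (a₃ i) * r₁) * r₂) ^ e i) *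
          (ψ A₀ + ψ A₁ * r₁ + (ψ A₂ + ψ A₃ * r₁) * r₂) ^ e')) :
    ∃ c : ClassGroup (𝓞 (κ.layer 2)), orderOf c = 4 := by
  classical
  haveI : Fact (Nat.Prime 2) := ⟨Nat.prime_two⟩
  -- the layers `K₁ ⊂ K₂` (the tree's layer-two lemmas are stated for `κ.layer (1 + 1)`; we bridge once by `rfl`)
  have h12 : κ.layer 1 ≤ κ.layer 2 := κ.layer_mono one_le_two
  letI alg : Algebra (κ.layer 1) (κ.layer 2) := (IntermediateField.inclusion h12).toRingHom.toAlgebra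
  haveI tow : IsScalarTower K (κ.layer 1) (κ.layer 2) :=
    IsScalarTower.of_algebraMap_eq fun x => ((IntermediateField.inclusion h12).commutes x).symm
  letI : Algebra (κ.layer 1) (κ.layer (1 + 1)) := alg
  haveI : IsScalarTower K (κ.layer 1) (κ.layer (1 + 1)) := tow
  haveI : FiniteDimensional K (κ.layer 1) := κ.finiteDimensional_layer_holds 1
  haveI : FiniteDimensional K (κ.layer 2) := κ.finiteDimensional_layer_holds 2
  haveI : NumberField (κ.layer 1) := NumberField.of_module_finite K _
  haveI : NumberField (κ.layer 2) := NumberField.of_module_finite K _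
  haveI : IsGalois K (κ.layer 1) := κ.isGalois_layer_holds 1
  haveI : IsGalois K (κ.layer 2) := κ.isGalois_layer_holds 2
  haveI : IsGalois (κ.layer 1) (κ.layer 2) := IsGalois.tower_top_of_isGalois K _ _
  haveI : FiniteDimensional (κ.layer 1) (κ.layer 2) := Module.Finite.of_restrictScalars_finite K _ _
  haveI : IsUnramifiedAtInfinitePlaces K (κ.layer 2) := κ.isUnramifiedAtInfinitePlaces_layer 2
  have hdeg1 : Module.finrank K (κ.layer 1) = 2 := by rw [κ.finrank_layer_holds 1, pow_one]
  have hdeg2 : Module.finrank (κ.layer 1) (κ.layer 2) = 2 := finrank_layer_one_layer_two κ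
  -- `s₁ = √2 ∈ K₁ ∖ K`, `s₂ = √(2+s₁) ∈ K₂ ∖ K₁`
  obtain ⟨s₁, hs₁, s₂', hs₂', hs₂K''⟩ := exists_sqrt_two_layer_one_sqrt_two_add_layer_two κ hK hκ
  set s₂ : κ.layer 2 := s₂' with hs₂def
  have hs₂ : s₂ ^ 2 = algebraMap (κ.layer 1) (κ.layer 2) (2 + s₁) := hs₂'
  have hs₂K : ∀ x : κ.layer 1, algebraMap (κ.layer 1) (κ.layer 2) x ≠ s₂ := fun x hx => hs₂K'' ⟨x, hx⟩
  clear_value s₂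
  clear hs₂' hs₂K'' hs₂def
  have hs₁K : ∀ x : K, algebraMap K (κ.layer 1) x ≠ s₁ := forall_algebraMap_ne_of_sq_eq_two hd hs₁
  -- a real place of `K₂` and the rank of `E_{K₂}`
  have hrealK : 0 < NumberField.InfinitePlace.nrRealPlaces K :=
    NumberField.InfinitePlace.nrRealPlaces_pos_of_odd_finrank (Nat.odd_iff.mpr (Nat.two_dvd_ne_zero.mp hK))
  have hreal : 0 < NumberField.InfinitePlace.nrRealPlaces (κ.layer 2) := by
    obtain ⟨⟨w₀, hw₀⟩⟩ := Fintype.card_pos_iff.mp hrealK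
    obtain ⟨w, hw⟩ := NumberField.InfinitePlace.comap_surjective (k := K) (K := κ.layer 2) w₀
    have hu : w.IsUnramified K := NumberField.InfinitePlace.isUnramified K w
    have hw' : w.comap (algebraMap K (κ.layer 2)) = w₀ := hw
    have hwr : w.IsReal := (NumberField.InfinitePlace.isUnramified_iff.mp hu).resolve_right (by
      rw [hw', NumberField.InfinitePlace.not_isComplex_iff_isReal]; exact hw₀)
    exact Fintype.card_pos_iff.mpr ⟨⟨w, hwr⟩⟩
  have hrank : NumberField.Units.rank (κ.layer 2) < n + 1 := by
    have hcard := IsUnramifiedAtInfinitePlaces.card_infinitePlace K (κ.layer 2)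
    rw [κ.finrank_layer_holds 2] at hcard
    have hpos : 0 < Fintype.card (NumberField.InfinitePlace (κ.layer 2)) := Fintype.card_pos
    rw [NumberField.Units.rank]
    norm_num at hcard
    omega
  -- the integral elements `S₁ = s₁`, `S₂ = s₂` of `𝓞 K₂`
  have hs₁int : IsIntegral ℤ s₁ := by
    refine ⟨Polynomial.X ^ 2 - Polynomial.C 2, Polynomial.monic_X_pow_sub_C _ two_ne_zero, ?_⟩
    simp [hs₁]
  have hS₁int : IsIntegral ℤ (algebraMap (κ.layer 1) (κ.layer 2) s₁) := map_isIntegral_int _ hs₁int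
  have h2int : IsIntegral ℤ (2 : κ.layer 2) := by
    have := isIntegral_algebraMap (R := ℤ) (A := κ.layer 2) (x := (2 : ℤ))
    rwa [map_ofNat] at this
  have hs₂int : IsIntegral ℤ s₂ := by
    refine IsIntegral.of_pow (n := 2) (by norm_num) ?_
    rw [hs₂, map_add, map_ofNat]
    exact h2int.add hS₁int
  obtain ⟨S₁, hS₁val⟩ : ∃ S : 𝓞 (κ.layer 2),
      algebraMap (𝓞 (κ.layer 2)) (κ.layer 2) S = algebraMap (κ.layer 1) (κ.layer 2) s₁ := ⟨⟨_, hS₁int⟩, rfl⟩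
  obtain ⟨S₂, hS₂val⟩ : ∃ S : 𝓞 (κ.layer 2), algebraMap (𝓞 (κ.layer 2)) (κ.layer 2) S = s₂ := ⟨⟨_, hs₂int⟩, rfl⟩
  have hS₁sq : S₁ ^ 2 = 2 := by
    apply RingOfIntegers.coe_injective
    rw [map_pow, map_ofNat, hS₁val, ← map_pow, hs₁, map_ofNat]
  have hS₂sq : S₂ ^ 2 = 2 + S₁ := by
    apply RingOfIntegers.coe_injective
    rw [map_pow, map_add, map_ofNat, hS₂val, hS₁val, hs₂, map_add, map_ofNat]
  set f := algebraMap (𝓞 K) (𝓞 (κ.layer 2)) with hf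
  have hcoe : ∀ z : 𝓞 K, algebraMap (𝓞 (κ.layer 2)) (κ.layer 2) (f z) = algebraMap K (κ.layer 2) (z : K) := fun z => by
    rw [hf]
    exact (IsScalarTower.algebraMap_apply (𝓞 K) (𝓞 (κ.layer 2)) (κ.layer 2) z).symm.trans
      (IsScalarTower.algebraMap_apply (𝓞 K) K (κ.layer 2) z)
  have hcoord : ∀ x₀ x₁ x₂ x₃ : 𝓞 K, ((f x₀ + f x₁ * S₁ + (f x₂ + f x₃ * S₁) * S₂ : 𝓞 (κ.layer 2)) : κ.layer 2) =
      algebraMap K (κ.layer 2) (x₀ : K) + algebraMap K (κ.layer 2) (x₁ : K) * algebraMap (κ.layer 1) (κ.layer 2) s₁ +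
      (algebraMap K (κ.layer 2) (x₂ : K) + algebraMap K (κ.layer 2) (x₃ : K) *
        algebraMap (κ.layer 1) (κ.layer 2) s₁) * s₂ := fun x₀ x₁ x₂ x₃ => by
    rw [RingOfIntegers.coe_eq_algebraMap]
    simp only [map_add, map_mul, hcoe, hS₁val, hS₂val]
  -- the product rule in `𝓞 K₂` on coordinates
  have hmul : ∀ x₀ x₁ x₂ x₃ y₀ y₁ y₂ y₃ : 𝓞 K,
      (f x₀ + f x₁ * S₁ + (f x₂ + f x₃ * S₁) * S₂) * (f y₀ + f y₁ * S₁ + (f y₂ + f y₃ * S₁) * S₂) =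
      f (x₀ * y₀ + 2 * x₁ * y₁ + 2 * (x₂ * y₂ + 2 * x₃ * y₃) + 2 * (x₂ * y₃ + x₃ * y₂)) +
      f (x₀ * y₁ + x₁ * y₀ + (x₂ * y₂ + 2 * x₃ * y₃) + 2 * (x₂ * y₃ + x₃ * y₂)) * S₁ +
      (f (x₀ * y₂ + 2 * x₁ * y₃ + x₂ * y₀ + 2 * x₃ * y₁) + f (x₀ * y₃ + x₁ * y₂ + x₂ * y₁ + x₃ * y₀) * S₁) * S₂ := by
    intro x₀ x₁ x₂ x₃ y₀ y₁ y₂ y₃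
    simp only [map_add, map_mul, map_ofNat]
    linear_combination (f x₁ * f y₁ + (f x₁ * f y₃ + f x₃ * f y₁) * S₂ + (f x₂ * f y₃ + f x₃ * f y₂) +
      f x₃ * f y₃ * (2 + S₁)) * hS₁sq + ((f x₂ + f x₃ * S₁) * (f y₂ + f y₃ * S₁)) * hS₂sq
  -- the units
  have hunit : ∀ i, (f (a₀ i) + f (a₁ i) * S₁ + (f (a₂ i) + f (a₃ i) * S₁) * S₂) *
      (f (c₀ i) + f (c₁ i) * S₁ + (f (c₂ i) + f (c₃ i) * S₁) * S₂) = 1 := by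
    intro i
    obtain ⟨h0, h1, h2, h3⟩ := hu i
    rw [hmul, h0, h1, h2, h3, map_one, map_zero]; ring
  set u : Fin n → (𝓞 (κ.layer 2))ˣ := fun i => Units.mkOfMulEqOne _ _ (hunit i) with hudef
  -- `w`, `w*`, `b = q₀`, `v` and the two ideal identities
  obtain ⟨w, hw⟩ : ∃ w : 𝓞 (κ.layer 2), w = f A₀ + f A₁ * S₁ + (f A₂ + f A₃ * S₁) * S₂ := ⟨_, rfl⟩
  obtain ⟨ws, hws'⟩ : ∃ ws : 𝓞 (κ.layer 2), ws = f W₀ + f W₁ * S₁ + (f W₂ + f W₃ * S₁) * S₂ := ⟨_, rfl⟩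
  obtain ⟨b, hb⟩ : ∃ b : 𝓞 (κ.layer 2), b = f q₀ := ⟨_, rfl⟩
  obtain ⟨v, hv⟩ : ∃ v : 𝓞 (κ.layer 2), v = f v₀ + f v₁ * S₁ + (f v₂ + f v₃ * S₁) * S₂ := ⟨_, rfl⟩
  have hb0 : b ≠ 0 := by
    intro h
    apply hq₀
    have h' : algebraMap (𝓞 (κ.layer 2)) (κ.layer 2) b = 0 := by rw [h, map_zero]
    rw [hb, hcoe, map_eq_zero_iff _ (algebraMap K (κ.layer 2)).injective] at h'
    exact RingOfIntegers.coe_injective (by simpa using h')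
  have hbv : b * v = f (q₀ * v₀) + f (q₀ * v₁) * S₁ + (f (q₀ * v₂) + f (q₀ * v₃) * S₁) * S₂ := by
    simp only [map_mul, hb, hv]; ring
  have hb2 : b ^ 2 = f (q₀ ^ 2) := by rw [hb, map_pow]
  have hvv : v ^ 2 = f V₀ + f V₁ * S₁ + (f V₂ + f V₃ * S₁) * S₂ := by
    obtain ⟨h0, h1, h2, h3⟩ := hV
    rw [sq, hv, hmul, h0, h1, h2, h3]
  have hI2 : (Ideal.span {b, v}) ^ 2 = Ideal.span {w, b ^ 2} := by
    refine span_pair_sq_eq_span_pair_of_witnesses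
      (α := f α₀ + f α₁ * S₁ + (f α₂ + f α₃ * S₁) * S₂) (β := f β₀ + f β₁ * S₁ + (f β₂ + f β₃ * S₁) * S₂)
      (α' := f γ₀ + f γ₁ * S₁ + (f γ₂ + f γ₃ * S₁) * S₂) (β' := f δ₀ + f δ₁ * S₁ + (f δ₂ + f δ₃ * S₁) * S₂)
      (α'' := f m₀ + f m₁ * S₁ + (f m₂ + f m₃ * S₁) * S₂) (β'' := f n₀ + f n₁ * S₁ + (f n₂ + f n₃ * S₁) * S₂)
      (γ'' := f l₀ + f l₁ * S₁ + (f l₂ + f l₃ * S₁) * S₂) ?_ ?_ ?_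
    · obtain ⟨h0, h1, h2, h3⟩ := hM2
      have e0 := congrArg f h0
      have e1 := congrArg f h1
      have e2 := congrArg f h2
      have e3 := congrArg f h3
      rw [map_add, map_mul f β₀ (q₀ ^ 2)] at e0
      rw [map_add, map_mul f β₁ (q₀ ^ 2)] at e1
      rw [map_add, map_mul f β₂ (q₀ ^ 2)] at e2
      rw [map_add, map_mul f β₃ (q₀ ^ 2)] at e3
      rw [hbv, hb2, hw, hmul]
      linear_combination e0 + S₁ * e1 + S₂ * e2 + S₁ * S₂ * e3
    · obtain ⟨h0, h1, h2, h3⟩ := hM3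
      have e0 := congrArg f h0
      have e1 := congrArg f h1
      have e2 := congrArg f h2
      have e3 := congrArg f h3
      rw [map_add, map_mul f δ₀ (q₀ ^ 2)] at e0
      rw [map_add, map_mul f δ₁ (q₀ ^ 2)] at e1
      rw [map_add, map_mul f δ₂ (q₀ ^ 2)] at e2
      rw [map_add, map_mul f δ₃ (q₀ ^ 2)] at e3
      rw [hvv, hb2, hw, hmul]
      linear_combination e0 + S₁ * e1 + S₂ * e2 + S₁ * S₂ * e3
    · obtain ⟨h0, h1, h2, h3⟩ := hM4
      have e0 := congrArg f h0
      have e1 := congrArg f h1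
      have e2 := congrArg f h2
      have e3 := congrArg f h3
      rw [map_add, map_add, map_mul f m₀ (q₀ ^ 2)] at e0
      rw [map_add, map_add, map_mul f m₁ (q₀ ^ 2)] at e1
      rw [map_add, map_add, map_mul f m₂ (q₀ ^ 2)] at e2
      rw [map_add, map_add, map_mul f m₃ (q₀ ^ 2)] at e3
      rw [hvv, hbv, hb2, hw, hmul, hmul]
      linear_combination e0 + S₁ * e1 + S₂ * e2 + S₁ * S₂ * e3
  have hI4 : (Ideal.span {w, b ^ 2}) ^ 2 = Ideal.span {w} := by
    refine span_pair_sq_eq_span_singleton_of_witnesses (ws := ws)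
      (μ := f μ₀ + f μ₁ * S₁ + (f μ₂ + f μ₃ * S₁) * S₂) (ν := f ν₀ + f ν₁ * S₁ + (f ν₂ + f ν₃ * S₁) * S₂) ?_ ?_
    · obtain ⟨h0, h1, h2, h3⟩ := hws
      have e0 := congrArg f h0
      have e1 := congrArg f h1
      have e2 := congrArg f h2
      have e3 := congrArg f h3
      rw [map_zero] at e1 e2 e3
      rw [hb, ← map_pow, hw, hws', hmul]
      linear_combination e0 + S₁ * e1 + S₂ * e2 + S₁ * S₂ * e3
    · obtain ⟨h0, h1, h2, h3⟩ := hbez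
      have e0 := congrArg f h0
      have e1 := congrArg f h1
      have e2 := congrArg f h2
      have e3 := congrArg f h3
      rw [map_add, map_one] at e0
      rw [map_add, map_zero] at e1 e2 e3
      rw [hw, hws', hmul, hmul]
      linear_combination e0 + S₁ * e1 + S₂ * e2 + S₁ * S₂ * e3
  obtain ⟨c, hc⟩ := exists_orderOf_eq_four_of_towerOrderFourCert (K := K) hdeg1 hdeg2 hs₁ hs₁K hs₂ hs₂K hreal hrank u
    a₀ a₁ a₂ a₃ (A₀ := A₀) (A₁ := A₁) (A₂ := A₂) (A₃ := A₃) (w := w) (b := b) (v := v)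
    (fun i => by rw [hudef, Units.val_mkOfMulEqOne]; exact hcoord _ _ _ _)
    (by rw [hw]; exact hcoord A₀ A₁ A₂ A₃) hb0 hI2 hI4 hcert
  exact ⟨c, hc⟩

/-- ★★★ **`μ₂ = 0`, `λ₂ ≤ 2`, `rank₂ Cl(K_m) ≤ 2 ∀ m` from the layer-two tower certificate**, for `K` with moreover `2 ∤ h_K` and `e₁ ≤ 1`: the class of
order `4` in `Cl(K_2)` (`exists_orderOf_eq_four_layer_two_of_towerCert`) is the input of att-p3 g47's elementary-layer door
`classicalMuVanishes_two_of_orderOf_eq_four_of_not_dvd_discr` at `k = 2`.  No class group, unit or element of any layer is an input: everything is an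
identity in `𝓞_K` or a residue computation in `ℤ/q`. [cite: Washington1997, §13.3 Lemmas 13.15, 13.18] [cite: NeukirchANT1999, Ch. I §7 Thm. (7.4), Ch. I §3]
[cite: Cohen1993, §6.5] -/
theorem classicalMuVanishes_two_of_layer_two_towerCert (hK : ¬ 2 ∣ Module.finrank ℚ K) (hd : ¬ (2 : ℤ) ∣ NumberField.discr K)
    (hh : ¬ 2 ∣ classNumber K) {n : ℕ} (hPl : 4 * Fintype.card (NumberField.InfinitePlace K) ≤ n + 1)
    (κ : ZpExtension K 2) (hκ : κ.IsCyclotomic) (h1 : classNumberPExp κ 1 ≤ 1)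
    (a₀ a₁ a₂ a₃ c₀ c₁ c₂ c₃ : Fin n → 𝓞 K)
    {A₀ A₁ A₂ A₃ W₀ W₁ W₂ W₃ μ₀ μ₁ μ₂ μ₃ ν₀ ν₁ ν₂ ν₃ q₀ v₀ v₁ v₂ v₃ α₀ α₁ α₂ α₃ β₀ β₁ β₂ β₃
      γ₀ γ₁ γ₂ γ₃ δ₀ δ₁ δ₂ δ₃ m₀ m₁ m₂ m₃ n₀ n₁ n₂ n₃ l₀ l₁ l₂ l₃ V₀ V₁ V₂ V₃ : 𝓞 K}
    (hu : ∀ i, a₀ i * c₀ i + 2 * a₁ i * c₁ i + 2 * (a₂ i * c₂ i + 2 * a₃ i * c₃ i) + 2 * (a₂ i * c₃ i + a₃ i * c₂ i) = 1 ∧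
      a₀ i * c₁ i + a₁ i * c₀ i + (a₂ i * c₂ i + 2 * a₃ i * c₃ i) + 2 * (a₂ i * c₃ i + a₃ i * c₂ i) = 0 ∧
      a₀ i * c₂ i + 2 * a₁ i * c₃ i + a₂ i * c₀ i + 2 * a₃ i * c₁ i = 0 ∧
      a₀ i * c₃ i + a₁ i * c₂ i + a₂ i * c₁ i + a₃ i * c₀ i = 0)
    (hws : q₀ ^ 4 = A₀ * W₀ + 2 * A₁ * W₁ + 2 * (A₂ * W₂ + 2 * A₃ * W₃) + 2 * (A₂ * W₃ + A₃ * W₂) ∧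
      (0 : 𝓞 K) = A₀ * W₁ + A₁ * W₀ + (A₂ * W₂ + 2 * A₃ * W₃) + 2 * (A₂ * W₃ + A₃ * W₂) ∧
      (0 : 𝓞 K) = A₀ * W₂ + 2 * A₁ * W₃ + A₂ * W₀ + 2 * A₃ * W₁ ∧
      (0 : 𝓞 K) = A₀ * W₃ + A₁ * W₂ + A₂ * W₁ + A₃ * W₀)
    (hbez : (μ₀ * A₀ + 2 * μ₁ * A₁ + 2 * (μ₂ * A₂ + 2 * μ₃ * A₃) + 2 * (μ₂ * A₃ + μ₃ * A₂)) +
        (ν₀ * W₀ + 2 * ν₁ * W₁ + 2 * (ν₂ * W₂ + 2 * ν₃ * W₃) + 2 * (ν₂ * W₃ + ν₃ * W₂)) = 1 ∧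
      (μ₀ * A₁ + μ₁ * A₀ + (μ₂ * A₂ + 2 * μ₃ * A₃) + 2 * (μ₂ * A₃ + μ₃ * A₂)) +
        (ν₀ * W₁ + ν₁ * W₀ + (ν₂ * W₂ + 2 * ν₃ * W₃) + 2 * (ν₂ * W₃ + ν₃ * W₂)) = 0 ∧
      (μ₀ * A₂ + 2 * μ₁ * A₃ + μ₂ * A₀ + 2 * μ₃ * A₁) + (ν₀ * W₂ + 2 * ν₁ * W₃ + ν₂ * W₀ + 2 * ν₃ * W₁) = 0 ∧
      (μ₀ * A₃ + μ₁ * A₂ + μ₂ * A₁ + μ₃ * A₀) + (ν₀ * W₃ + ν₁ * W₂ + ν₂ * W₁ + ν₃ * W₀) = 0)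
    (hq₀ : q₀ ≠ 0)
    (hM2 : q₀ * v₀ = (α₀ * A₀ + 2 * α₁ * A₁ + 2 * (α₂ * A₂ + 2 * α₃ * A₃) + 2 * (α₂ * A₃ + α₃ * A₂)) + β₀ * q₀ ^ 2 ∧
      q₀ * v₁ = (α₀ * A₁ + α₁ * A₀ + (α₂ * A₂ + 2 * α₃ * A₃) + 2 * (α₂ * A₃ + α₃ * A₂)) + β₁ * q₀ ^ 2 ∧
      q₀ * v₂ = (α₀ * A₂ + 2 * α₁ * A₃ + α₂ * A₀ + 2 * α₃ * A₁) + β₂ * q₀ ^ 2 ∧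
      q₀ * v₃ = (α₀ * A₃ + α₁ * A₂ + α₂ * A₁ + α₃ * A₀) + β₃ * q₀ ^ 2)
    (hV : v₀ * v₀ + 2 * v₁ * v₁ + 2 * (v₂ * v₂ + 2 * v₃ * v₃) + 2 * (v₂ * v₃ + v₃ * v₂) = V₀ ∧
      v₀ * v₁ + v₁ * v₀ + (v₂ * v₂ + 2 * v₃ * v₃) + 2 * (v₂ * v₃ + v₃ * v₂) = V₁ ∧
      v₀ * v₂ + 2 * v₁ * v₃ + v₂ * v₀ + 2 * v₃ * v₁ = V₂ ∧
      v₀ * v₃ + v₁ * v₂ + v₂ * v₁ + v₃ * v₀ = V₃)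
    (hM3 : V₀ = (γ₀ * A₀ + 2 * γ₁ * A₁ + 2 * (γ₂ * A₂ + 2 * γ₃ * A₃) + 2 * (γ₂ * A₃ + γ₃ * A₂)) + δ₀ * q₀ ^ 2 ∧
      V₁ = (γ₀ * A₁ + γ₁ * A₀ + (γ₂ * A₂ + 2 * γ₃ * A₃) + 2 * (γ₂ * A₃ + γ₃ * A₂)) + δ₁ * q₀ ^ 2 ∧
      V₂ = (γ₀ * A₂ + 2 * γ₁ * A₃ + γ₂ * A₀ + 2 * γ₃ * A₁) + δ₂ * q₀ ^ 2 ∧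
      V₃ = (γ₀ * A₃ + γ₁ * A₂ + γ₂ * A₁ + γ₃ * A₀) + δ₃ * q₀ ^ 2)
    (hM4 : A₀ = m₀ * q₀ ^ 2 + (n₀ * (q₀ * v₀) + 2 * n₁ * (q₀ * v₁) + 2 * (n₂ * (q₀ * v₂) + 2 * n₃ * (q₀ * v₃)) +
        2 * (n₂ * (q₀ * v₃) + n₃ * (q₀ * v₂))) + (l₀ * V₀ + 2 * l₁ * V₁ + 2 * (l₂ * V₂ + 2 * l₃ * V₃) + 2 * (l₂ * V₃ + l₃ * V₂)) ∧
      A₁ = m₁ * q₀ ^ 2 + (n₀ * (q₀ * v₁) + n₁ * (q₀ * v₀) + (n₂ * (q₀ * v₂) + 2 * n₃ * (q₀ * v₃)) +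
        2 * (n₂ * (q₀ * v₃) + n₃ * (q₀ * v₂))) + (l₀ * V₁ + l₁ * V₀ + (l₂ * V₂ + 2 * l₃ * V₃) + 2 * (l₂ * V₃ + l₃ * V₂)) ∧
      A₂ = m₂ * q₀ ^ 2 + (n₀ * (q₀ * v₂) + 2 * n₁ * (q₀ * v₃) + n₂ * (q₀ * v₀) + 2 * n₃ * (q₀ * v₁)) +
        (l₀ * V₂ + 2 * l₁ * V₃ + l₂ * V₀ + 2 * l₃ * V₁) ∧
      A₃ = m₃ * q₀ ^ 2 + (n₀ * (q₀ * v₃) + n₁ * (q₀ * v₂) + n₂ * (q₀ * v₁) + n₃ * (q₀ * v₀)) +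
        (l₀ * V₃ + l₁ * V₂ + l₂ * V₁ + l₃ * V₀))
    (hcert : ∀ (e : Fin n → ℕ) (e' : ℕ) (σ : ℤˣ), (∀ i, e i ≤ 1) → e' ≤ 1 → ¬ (e = 0 ∧ e' = 0 ∧ σ = 1) →
      ∃ (q : ℕ) (ψ : 𝓞 K →+* ZMod q) (t r₁ r₂ : ZMod q), 2 * t = 1 ∧ r₁ ^ 2 = 2 ∧ r₂ ^ 2 = 2 + r₁ ∧
        ¬ IsSquare (((σ : ℤ) : ZMod q) *
          (∏ i, (ψ (a₀ i) + ψ (a₁ i) * r₁ + (ψ (a₂ i) + ψ (a₃ i) * r₁) * r₂) ^ e i) *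
          (ψ A₀ + ψ A₁ * r₁ + (ψ A₂ + ψ A₃ * r₁) * r₂) ^ e')) :
    (∀ m, classGroupPRank κ m ≤ 2) ∧ ClassicalMuVanishes κ ∧ classicalLambda κ ≤ 2 := by
  obtain ⟨c, hc⟩ := exists_orderOf_eq_four_layer_two_of_towerCert hK hd hPl κ hκ a₀ a₁ a₂ a₃ c₀ c₁ c₂ c₃ hu hws hbez hq₀
    hM2 hV hM3 hM4 hcert
  have h := classicalMuVanishes_two_of_orderOf_eq_four_of_not_dvd_discr hK hd hh κ hκ h1 (k := 2) hc
  norm_num at h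
  exact h

end Literature.NumberTheory.IwasawaTheory

end
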